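import Literature.Analysis.Complex.RiemannSphereHolderSections
import Literature.Analysis.Complex.DbarAlongHolomorphic
import Mathlib.Analysis.Complex.Liouville
import Mathlib.Analysis.Complex.RemovableSingularity
import HarnessLib

/-!
# The kernel of `∂̄` on Hölder sections of `O(n)` over the Riemann sphere: polynomials of degree `≤ n`

Topic `Literature/Analysis/Complex`. In the two-chart description of the Riemann sphere
`S² = ℂ_z ∪ ℂ_w` (`w = z⁻¹`) of `Literature/Analysis/Complex/RiemannSphereHolderSections.lean`, the
holomorphic line bundle `O(n)` (`n : ℕ`) is the bundle with clutching function `τ w = ε wⁿ`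
(`ε ≠ 0` a normalisation constant: `ε = 1`, `n = 0` are the functions, `ε = -1`, `n = 2` the
tangent bundle `ξ₀ ∂_z ↔ ξ₁ ∂_w`, `ξ₁ w = -w² ξ₀ w⁻¹`), a section being a clutched pair
`f₁ w = ε wⁿ • f₀ w⁻¹` of chart representatives. For a member `p` of the Hölder space
`𝓗^{k+1,r}_τ(F) = RiemannSphere.holderSections F τ (k + 1) r` with representatives
`sec₀ τ p`, `sec₁ τ p` we prove:

* `RiemannSphere.eq_polynomial_of_dbar_eq_zero` — **the kernel of `∂̄` consists of polynomials of
  degree `≤ n`**: if `∂̄ (sec₀ τ p) = 0` on `ℂ` then `sec₀ τ p z = ∑_{i ≤ n} zⁱ • cᵢ` for some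
  `c₀, …, cₙ ∈ F`. Proof: `sec₀ τ p` is `C¹` with `∂̄ = 0`, hence entire
  (`differentiableAt_complex_iff_dbarAlong_eq_zero`); the clutching relation
  `sec₀ τ p z = ε⁻¹ zⁿ • g₁ z⁻¹` for `‖z‖ > 1/2` and the boundedness of the second piece `g₁` give
  `‖sec₀ τ p z‖ ≤ C ‖z‖ⁿ` for `‖z‖ ≥ 1`; an entire function of polynomial growth of order `n` is
  a polynomial of degree `≤ n` (`exists_eq_sum_smul_of_differentiable_of_norm_le`, by induction on
  `n` with `dslope` and Liouville's theorem, the vector-valued version of the tree's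
  `Literature.Analysis.Complex.exists_eq_sum_of_differentiable_of_growth`).
* `RiemannSphere.polynomial_mem` — conversely every polynomial of degree `≤ n` is the
  `z`-representative of a member of `𝓗^{k+1,r}_τ(F)` (`r ≤ 1`) with `w`-representative
  `ε • ∑ w^{n-i} • cᵢ`, both `∂̄`-closed.
* `RiemannSphere.sec₀_eq_sec₀_zero_of_dbar_eq_zero`, `RiemannSphere.eq_of_dbar_sec₀_eq` — the
  case of functions (`τ = 1`): the kernel consists of the constants, and two members with the same
  `∂̄` and the same value at `z = 0` coincide;
* `RiemannSphere.eq_const_of_dbar_eq_zero_one`, `RiemannSphere.const_mem_one`,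
  `RiemannSphere.eq_quadratic_of_dbar_eq_zero_neg_sq`, `RiemannSphere.quadratic_mem_neg_sq` — the
  same statements in the syntactic forms `holderSections F (1 : ℂ → ℂ) k r` (functions) and
  `holderSections F (fun w : ℂ => -w ^ 2) k r` (vector fields; kernel = quadratic polynomials,
  the Möbius Lie algebra) used by `Literature/Analysis/Complex/RiemannSphereDbar.lean`.

This is `h⁰(ℂℙ¹, O(n)) = n + 1` in Hölder classes, the kernel count in the Riemann–Roch input of
the implicit-function-theorem construction of embedded `J`-holomorphic spheres (Wendl 2018,
Thm. 2.46, Prop. 2.53; the Möbius Lie algebra `{(a + b z + c z²) ∂_z}` for `n = 2`). The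
surjectivity half (`H^{0,1}(ℂℙ¹, O(n)) = 0`, a bounded right inverse of `∂̄`) is
`Literature/Analysis/Complex/RiemannSphereDbarRightInverse.lean`.

## References

* C. Wendl, *Holomorphic Curves in Low Dimensions*, LNM 2216 (2018), §2.1.3, Thm. 2.46,
  Prop. 2.53. [Wendl2018]
* D. McDuff, D. Salamon, *J-holomorphic curves and symplectic topology*, 2nd ed. (2012), App. C.
  [McDuffSalamon2012]
-/

noncomputable section

open Set Filter Metric Function
open scoped Topology NNReal ContDiff

namespace Literature.Analysis.Complex

open _root_.Complex

/-! ### Entire functions of polynomial growth are polynomials (vector-valued) -/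

section Liouville

variable {F : Type*} [NormedAddCommGroup F] [NormedSpace ℂ F] [CompleteSpace F]

/-- **Liouville's theorem for polynomial growth, vector-valued.** An entire function
`f : ℂ → F` with `‖f z‖ ≤ C ‖z‖ⁿ` for `‖z‖ ≥ 1` is a polynomial of degree `≤ n` with
coefficients in `F`: `f z = ∑_{i ≤ n} zⁱ • cᵢ`. Induction on `n`: for `n = 0`, `f` is bounded
hence constant; in general `dslope f 0` is entire with growth of order `n - 1`, and
`f z = f 0 + z • dslope f 0 z`. [folklore] -/
theorem exists_eq_sum_smul_of_differentiable_of_norm_le (n : ℕ) :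
    ∀ (f : ℂ → F) (C : ℝ), Differentiable ℂ f → (∀ z : ℂ, 1 ≤ ‖z‖ → ‖f z‖ ≤ C * ‖z‖ ^ n) →
      ∃ c : Fin (n + 1) → F, ∀ z, f z = ∑ i : Fin (n + 1), z ^ (i : ℕ) • c i := by
  induction n with
  | zero =>
    intro f C hf hb
    -- `f` is bounded, hence constant
    obtain ⟨M, hM⟩ : ∃ M, ∀ z ∈ closedBall (0 : ℂ) 1, ‖f z‖ ≤ M :=
      (isCompact_closedBall 0 1).exists_bound_of_continuousOn hf.continuous.continuousOn
    have hbound : ∀ z, ‖f z‖ ≤ max M C := fun z => by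
      rcases le_or_gt ‖z‖ 1 with h | h
      · exact (hM z (by simpa using h)).trans (le_max_left _ _)
      · have := hb z h.le
        rw [pow_zero, mul_one] at this
        exact this.trans (le_max_right _ _)
    have hrange : Bornology.IsBounded (range f) :=
      isBounded_iff_forall_norm_le.mpr ⟨_, by rintro _ ⟨z, rfl⟩; exact hbound z⟩
    refine ⟨fun _ => f 0, fun z => ?_⟩
    rw [Fin.sum_univ_one, Fin.val_zero, pow_zero, one_smul]
    exact hf.apply_eq_apply_of_bounded hrange z 0
  | succ n ih =>
    intro f C hf hb
    set g : ℂ → F := dslope f 0 with hg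
    have hgd : Differentiable ℂ g :=
      differentiableOn_univ.mp ((differentiableOn_dslope univ_mem).mpr hf.differentiableOn)
    -- growth of `g`
    have hgb : ∀ z : ℂ, 1 ≤ ‖z‖ → ‖g z‖ ≤ (max C 0 + ‖f 0‖) * ‖z‖ ^ n := by
      intro z hz
      have hz0 : z ≠ 0 := by
        rintro rfl
        norm_num at hz
      have hzpos : 0 < ‖z‖ := norm_pos_iff.mpr hz0
      have hgz : g z = z⁻¹ • (f z - f 0) := by
        rw [hg, dslope_of_ne _ hz0, slope_def_module, sub_zero]
      have h1 : ‖f z - f 0‖ ≤ (max C 0 + ‖f 0‖) * ‖z‖ ^ (n + 1) := by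
        have hzn : 1 ≤ ‖z‖ ^ (n + 1) := one_le_pow₀ hz
        calc ‖f z - f 0‖ ≤ ‖f z‖ + ‖f 0‖ := norm_sub_le _ _
          _ ≤ C * ‖z‖ ^ (n + 1) + ‖f 0‖ * ‖z‖ ^ (n + 1) := by
              refine add_le_add (hb z hz) ?_
              exact le_mul_of_one_le_right (norm_nonneg _) hzn
          _ ≤ max C 0 * ‖z‖ ^ (n + 1) + ‖f 0‖ * ‖z‖ ^ (n + 1) := by
              gcongr
              exact le_max_left _ _
          _ = (max C 0 + ‖f 0‖) * ‖z‖ ^ (n + 1) := by ring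
      rw [hgz, norm_smul, norm_inv]
      calc ‖z‖⁻¹ * ‖f z - f 0‖ ≤ ‖z‖⁻¹ * ((max C 0 + ‖f 0‖) * ‖z‖ ^ (n + 1)) := by
            gcongr
        _ = (max C 0 + ‖f 0‖) * ‖z‖ ^ n := by
            field_simp
            ring
    obtain ⟨c, hc⟩ := ih g _ hgd hgb
    refine ⟨Fin.cons (f 0) c, fun z => ?_⟩
    have hfz : f z = f 0 + z • g z := by
      have h1 := sub_smul_dslope f 0 z
      rw [sub_zero, ← hg] at h1
      rw [h1]
      abel
    rw [hfz, Fin.sum_univ_succ, hc z, Finset.smul_sum]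
    simp only [Fin.cons_zero, Fin.cons_succ, Fin.val_succ, Fin.val_zero, pow_zero, one_smul,
      smul_smul, pow_succ']

end Liouville

/-! ### One-variable Cauchy–Riemann: `∂̄ u = 0` iff holomorphic -/

section OneVariable

variable {F : Type*} [NormedAddCommGroup F] [NormedSpace ℂ F]

/-- In one variable, `∂̄_v u = v̄ • ∂̄ u`, so `∂̄ u (z) = 0` gives `∂̄_v u (z) = 0` for every
direction `v`. [folklore] -/
theorem dbarAlong_eq_zero_of_dbarAlong_one_eq_zero {u : ℂ → F} {z : ℂ} (h : dbarAlong 1 u z = 0)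
    (v : ℂ) : dbarAlong v u z = 0 := by
  have hv : v = v • (1 : ℂ) := by rw [smul_eq_mul, mul_one]
  rw [hv, dbarAlong_smul_left, h, smul_zero]

/-- **A real-differentiable function of one complex variable with `∂̄ u (z) = 0` is
complex-differentiable at `z`.** [folklore] -/
theorem differentiableAt_complex_of_dbarAlong_one_eq_zero {u : ℂ → F} {z : ℂ}
    (hu : DifferentiableAt ℝ u z) (h : dbarAlong 1 u z = 0) : DifferentiableAt ℂ u z :=
  (differentiableAt_complex_iff_dbarAlong_eq_zero hu).2
    (dbarAlong_eq_zero_of_dbarAlong_one_eq_zero h)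

/-- **A `C¹` function on `ℂ` with `∂̄ u = 0` everywhere is entire.** [folklore] -/
theorem differentiable_complex_of_dbarAlong_one_eq_zero {u : ℂ → F} (hu : Differentiable ℝ u)
    (h : ∀ z, dbarAlong 1 u z = 0) : Differentiable ℂ u := fun z =>
  differentiableAt_complex_of_dbarAlong_one_eq_zero (hu z) (h z)

end OneVariable

namespace RiemannSphere

open Literature.Analysis.FunctionSpaces

variable {F : Type} [NormedAddCommGroup F] [NormedSpace ℂ F]

/-! ### The clutching function `τ w = ε wⁿ` of `O(n)` -/

/-- `τ w = ε wⁿ` is zero-free off the origin (`ε ≠ 0`). [folklore] -/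
theorem monomialClutch_ne_zero {ε : ℂ} (hε : ε ≠ 0) (n : ℕ) (w : ℂ) (hw : w ≠ 0) :
    ε * w ^ n ≠ 0 :=
  mul_ne_zero hε (pow_ne_zero n hw)

/-- `τ w = ε wⁿ` is real-smooth (off the origin, as the `holderSections` API wants it).
[folklore] -/
theorem contDiffOn_monomialClutch (ε : ℂ) (n : ℕ) :
    ContDiffOn ℝ ∞ (fun w : ℂ => ε * w ^ n) {w | w ≠ 0} :=
  ((contDiff_const.mul (contDiff_id.pow n) : ContDiff ℂ ∞ fun w : ℂ => ε * w ^ n).restrict_scalars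
    ℝ).contDiffOn

/-! ### Growth of the `z`-representative of a member of `𝓗^{k,r}_{ε wⁿ}` -/

section Growth

variable {k : ℕ} {r : ℝ≥0}

/-- **Polynomial growth of the `z`-representative**: for a member `p` of `𝓗^{k,r}_τ(F)`,
`τ w = ε wⁿ`, one has `‖sec₀ τ p z‖ ≤ ‖ε‖⁻¹ ‖g₁‖ ‖z‖ⁿ` for `‖z‖ ≥ 1`, from the clutching
relation `sec₀ τ p z = (ε z⁻ⁿ)⁻¹ • g₁ z⁻¹` (`‖z‖ > 1/2`) and `‖g₁ w‖ ≤ ‖g₁‖_{C^{k,r}}`.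
[folklore] -/
theorem norm_sec₀_le_of_one_le {ε : ℂ} (n : ℕ)
    {p : ContDiffHolderFunction ℂ F k r × ContDiffHolderFunction ℂ F k r}
    (hp : p ∈ holderSections F (fun w : ℂ => ε * w ^ n) k r) {z : ℂ} (hz : 1 ≤ ‖z‖) :
    ‖sec₀ (fun w : ℂ => ε * w ^ n) p z‖ ≤ ‖ε‖⁻¹ * ‖p.2‖ * ‖z‖ ^ n := by
  have hz' : 2⁻¹ < ‖z‖ := lt_of_lt_of_le (by norm_num) hz
  rw [sec₀_of_half_lt hp hz', norm_smul, norm_inv, norm_mul, norm_pow, norm_inv, inv_pow,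
    mul_inv, inv_inv]
  calc ‖ε‖⁻¹ * ‖z‖ ^ n * ‖p.2 z⁻¹‖ ≤ ‖ε‖⁻¹ * ‖z‖ ^ n * ‖p.2‖ := by
        gcongr
        exact p.2.norm_apply_le_norm _
    _ = ‖ε‖⁻¹ * ‖p.2‖ * ‖z‖ ^ n := by ring

end Growth

/-! ### The kernel of `∂̄`: polynomials of degree `≤ n` -/

section Kernel

variable [CompleteSpace F] {k : ℕ} {r : ℝ≥0}

/-- **The kernel of `∂̄` on `𝓗^{k+1,r}_{O(n)}` consists of polynomials of degree `≤ n`** (the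
`z`-chart half of the hypothesis suffices; the clutching function is any `τ` with `τ w = ε wⁿ`):
if the `z`-representative `f₀ = sec₀ τ p` of a member `p ∈ 𝓗^{k+1,r}_τ(F)`, `ε ≠ 0`, satisfies
`∂̄ f₀ = 0` on `ℂ`, then `f₀ z = ∑_{i ≤ n} zⁱ • cᵢ`. Indeed `f₀ ∈ C^{k+1} ⊆ C¹` with `∂̄ f₀ = 0`
is entire, and `‖f₀ z‖ ≤ C ‖z‖ⁿ` for `‖z‖ ≥ 1` (`norm_sec₀_le_of_one_le`), so Liouville's theorem
for polynomial growth applies (`h⁰(ℂℙ¹, O(n)) ≤ n + 1`; Wendl 2018, proof of Prop. 2.53 /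
Riemann–Roch for line bundles over `S²`). [cite: Wendl2018, Prop. 2.53] -/
theorem eq_polynomial_of_dbar₀_eq_zero' {τ : ℂ → ℂ} (ε : ℂ) (hε : ε ≠ 0) (n : ℕ)
    (hτ : ∀ w, τ w = ε * w ^ n) (k : ℕ) (p : holderSections F τ (k + 1) r)
    (h₀ : ∀ z : ℂ, dbarAlong 1 (sec₀ τ
      (p : ContDiffHolderFunction ℂ F (k + 1) r × ContDiffHolderFunction ℂ F (k + 1) r)) z = 0) :
    ∃ c : Fin (n + 1) → F, ∀ z : ℂ, sec₀ τ
      (p : ContDiffHolderFunction ℂ F (k + 1) r × ContDiffHolderFunction ℂ F (k + 1) r) z =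
        ∑ i : Fin (n + 1), z ^ (i : ℕ) • c i := by
  obtain rfl : τ = fun w => ε * w ^ n := funext hτ
  set f₀ := sec₀ (fun w : ℂ => ε * w ^ n)
    (p : ContDiffHolderFunction ℂ F (k + 1) r × ContDiffHolderFunction ℂ F (k + 1) r) with hf₀
  have hcd : ContDiff ℝ (k + 1 : ℕ) f₀ :=
    contDiff_sec₀ p.2 (monomialClutch_ne_zero hε n) (contDiffOn_monomialClutch ε n)
  have hdiff : Differentiable ℝ f₀ := hcd.differentiable (by exact_mod_cast Nat.succ_ne_zero k)
  have hhol : Differentiable ℂ f₀ := differentiable_complex_of_dbarAlong_one_eq_zero hdiff h₀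
  exact exists_eq_sum_smul_of_differentiable_of_norm_le n f₀ _ hhol
    fun z hz => norm_sec₀_le_of_one_le n p.2 hz

/-- **The kernel of `∂̄` on `𝓗^{k+1,r}_{O(n)}` consists of polynomials of degree `≤ n`**,
clutching function `τ w = ε wⁿ` written out, `z`-chart hypothesis only.
[cite: Wendl2018, Prop. 2.53] -/
theorem eq_polynomial_of_dbar₀_eq_zero (ε : ℂ) (hε : ε ≠ 0) (n k : ℕ)
    (p : holderSections F (fun w : ℂ => ε * w ^ n) (k + 1) r)
    (h₀ : ∀ z : ℂ, dbarAlong 1 (sec₀ (fun w : ℂ => ε * w ^ n)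
      (p : ContDiffHolderFunction ℂ F (k + 1) r × ContDiffHolderFunction ℂ F (k + 1) r)) z = 0) :
    ∃ c : Fin (n + 1) → F, ∀ z : ℂ, sec₀ (fun w : ℂ => ε * w ^ n)
      (p : ContDiffHolderFunction ℂ F (k + 1) r × ContDiffHolderFunction ℂ F (k + 1) r) z =
        ∑ i : Fin (n + 1), z ^ (i : ℕ) • c i :=
  eq_polynomial_of_dbar₀_eq_zero' ε hε n (fun _ => rfl) k p h₀

/-- **The kernel of `∂̄` on `𝓗^{k+1,r}_{O(n)}` consists of polynomials of degree `≤ n`**, stated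
with both chart hypotheses `∂̄ (sec₀ τ p) = 0`, `∂̄ (sec₁ τ p) = 0` (the second is implied by the
first through the clutching relation and is not used). [cite: Wendl2018, Prop. 2.53] -/
theorem eq_polynomial_of_dbar_eq_zero (ε : ℂ) (hε : ε ≠ 0) (n k : ℕ)
    (p : holderSections F (fun w : ℂ => ε * w ^ n) (k + 1) r)
    (h₀ : ∀ z : ℂ, dbarAlong 1 (sec₀ (fun w : ℂ => ε * w ^ n)
      (p : ContDiffHolderFunction ℂ F (k + 1) r × ContDiffHolderFunction ℂ F (k + 1) r)) z = 0)
    (_h₁ : ∀ w : ℂ, dbarAlong 1 (sec₁ (fun w : ℂ => ε * w ^ n)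
      (p : ContDiffHolderFunction ℂ F (k + 1) r × ContDiffHolderFunction ℂ F (k + 1) r)) w = 0) :
    ∃ c : Fin (n + 1) → F, ∀ z : ℂ, sec₀ (fun w : ℂ => ε * w ^ n)
      (p : ContDiffHolderFunction ℂ F (k + 1) r × ContDiffHolderFunction ℂ F (k + 1) r) z =
        ∑ i : Fin (n + 1), z ^ (i : ℕ) • c i :=
  eq_polynomial_of_dbar₀_eq_zero ε hε n k p h₀

end Kernel

/-! ### Polynomials of degree `≤ n` are `∂̄`-closed members -/

section Polynomial

variable {k : ℕ} {r : ℝ≥0}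

/-- A vector-valued polynomial `z ↦ ∑ᵢ z^{e i} • cᵢ` is entire. [folklore] -/
theorem differentiable_sum_pow_smul {ι : Type*} (s : Finset ι) (e : ι → ℕ) (c : ι → F) :
    Differentiable ℂ fun z : ℂ => ∑ i ∈ s, z ^ e i • c i := by
  refine Differentiable.fun_sum fun i _ => ?_
  exact (differentiable_id.pow _).smul_const _

/-- A vector-valued polynomial `z ↦ ∑ᵢ z^{e i} • cᵢ` is real-smooth. [folklore] -/
theorem contDiff_sum_pow_smul {ι : Type*} (s : Finset ι) (e : ι → ℕ) (c : ι → F) :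
    ContDiff ℝ ∞ fun z : ℂ => ∑ i ∈ s, z ^ e i • c i := by
  have h : ContDiff ℂ ∞ fun z : ℂ => ∑ i ∈ s, z ^ e i • c i :=
    ContDiff.sum fun i _ => (contDiff_id.pow _).smul contDiff_const
  exact h.restrict_scalars ℝ

/-- **Polynomials of degree `≤ n` are members of `𝓗^{k,r}_{O(n)}` with `∂̄ = 0`** (`r ≤ 1`): for
`c₀, …, cₙ ∈ F` the smooth clutched pair `f₀ z = ∑ᵢ zⁱ • cᵢ`, `f₁ w = ε • ∑ᵢ w^{n-i} • cᵢ`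
(`f₁ w = ε wⁿ • f₀ w⁻¹`) defines a member whose chart representatives are `f₀`, `f₁`, both
holomorphic (`h⁰(ℂℙ¹, O(n)) ≥ n + 1`). [cite: Wendl2018, Prop. 2.53] -/
theorem polynomial_mem (ε : ℂ) (hε : ε ≠ 0) (n k : ℕ) (hr : r ≤ 1) (c : Fin (n + 1) → F) :
    ∃ p : holderSections F (fun w : ℂ => ε * w ^ n) k r,
      (∀ z : ℂ, sec₀ (fun w : ℂ => ε * w ^ n)
        (p : ContDiffHolderFunction ℂ F k r × ContDiffHolderFunction ℂ F k r) z =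
          ∑ i : Fin (n + 1), z ^ (i : ℕ) • c i) ∧
      (∀ w : ℂ, sec₁ (fun w : ℂ => ε * w ^ n)
        (p : ContDiffHolderFunction ℂ F k r × ContDiffHolderFunction ℂ F k r) w =
          ε • ∑ i : Fin (n + 1), w ^ (n - (i : ℕ)) • c i) ∧
      (∀ z : ℂ, dbarAlong 1 (sec₀ (fun w : ℂ => ε * w ^ n)
        (p : ContDiffHolderFunction ℂ F k r × ContDiffHolderFunction ℂ F k r)) z = 0) ∧
      (∀ w : ℂ, dbarAlong 1 (sec₁ (fun w : ℂ => ε * w ^ n)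
        (p : ContDiffHolderFunction ℂ F k r × ContDiffHolderFunction ℂ F k r)) w = 0) := by
  set f₀ : ℂ → F := fun z => ∑ i : Fin (n + 1), z ^ (i : ℕ) • c i with hf₀
  set f₁ : ℂ → F := fun w => ε • ∑ i : Fin (n + 1), w ^ (n - (i : ℕ)) • c i with hf₁
  have hd₀ : Differentiable ℂ f₀ := differentiable_sum_pow_smul _ _ c
  have hd₁ : Differentiable ℂ f₁ := (differentiable_sum_pow_smul _ _ c).const_smul ε
  have hclutch : ∀ w : ℂ, w ≠ 0 → f₁ w = (ε * w ^ n) • f₀ w⁻¹ := by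
    intro w hw
    simp only [hf₀, hf₁, Finset.smul_sum, smul_smul]
    refine Finset.sum_congr rfl fun i _ => ?_
    congr 1
    rw [inv_pow, ← div_eq_mul_inv, mul_div_assoc, pow_sub₀ _ hw (Nat.lt_succ_iff.1 i.2),
      div_eq_mul_inv]
  let s : SmoothSection F (fun w : ℂ => ε * w ^ n) :=
    { f₀ := f₀
      f₁ := f₁
      smooth₀ := contDiff_sum_pow_smul _ _ c
      smooth₁ := by
        have h : ContDiff ℂ ∞ f₁ :=
          (ContDiff.sum fun i _ => (contDiff_id.pow _).smul contDiff_const).const_smul ε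
        exact h.restrict_scalars ℝ
      clutch := hclutch }
  have hτ : ∀ w : ℂ, w ≠ 0 → ε * w ^ n ≠ 0 := monomialClutch_ne_zero hε n
  refine ⟨s.toHolder hτ hr, fun z => s.sec₀_toHolder hτ hr z, fun w => s.sec₁_toHolder hτ hr w,
    fun z => ?_, fun w => ?_⟩
  · rw [show sec₀ (fun w : ℂ => ε * w ^ n) (s.toHolder (k := k) hτ hr :
        ContDiffHolderFunction ℂ F k r × ContDiffHolderFunction ℂ F k r) = f₀ from
      funext fun z => s.sec₀_toHolder hτ hr z]
    exact dbarAlong_eq_zero_of_differentiableAt (hd₀ z) 1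
  · rw [show sec₁ (fun w : ℂ => ε * w ^ n) (s.toHolder (k := k) hτ hr :
        ContDiffHolderFunction ℂ F k r × ContDiffHolderFunction ℂ F k r) = f₁ from
      funext fun w => s.sec₁_toHolder hτ hr w]
    exact dbarAlong_eq_zero_of_differentiableAt (hd₁ w) 1

end Polynomial

/-! ### Functions on the sphere (`τ = 1`): constants, and injectivity of `∂̄` modulo constants -/

section Functions

variable [CompleteSpace F] {k : ℕ} {r : ℝ≥0}

omit [CompleteSpace F] in
/-- `sec₀` is compatible with subtraction of pairs of pieces. [folklore] -/
theorem sec₀_sub (τ : ℂ → ℂ) (p q : ContDiffHolderFunction ℂ F k r × ContDiffHolderFunction ℂ F k r)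
    (z : ℂ) : sec₀ τ (p - q) z = sec₀ τ p z - sec₀ τ q z := by
  by_cases hz : ‖z‖ < 2 <;> simp [sec₀, hz, smul_sub]

/-- **On functions (`τ = 1`) the kernel of `∂̄` consists of the constants**: a member
`p ∈ 𝓗^{k+1,r}_1(F)` with `∂̄ (sec₀ 1 p) = 0` has constant `z`-representative (the case `n = 0`
of `eq_polynomial_of_dbar₀_eq_zero'`; Liouville on `S²`). [folklore] -/
theorem sec₀_eq_sec₀_zero_of_dbar_eq_zero (k : ℕ) (p : holderSections F (fun _ : ℂ => (1 : ℂ)) (k + 1) r)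
    (h₀ : ∀ z : ℂ, dbarAlong 1 (sec₀ (fun _ : ℂ => (1 : ℂ))
      (p : ContDiffHolderFunction ℂ F (k + 1) r × ContDiffHolderFunction ℂ F (k + 1) r)) z = 0)
    (z : ℂ) :
    sec₀ (fun _ : ℂ => (1 : ℂ))
        (p : ContDiffHolderFunction ℂ F (k + 1) r × ContDiffHolderFunction ℂ F (k + 1) r) z =
      sec₀ (fun _ : ℂ => (1 : ℂ))
        (p : ContDiffHolderFunction ℂ F (k + 1) r × ContDiffHolderFunction ℂ F (k + 1) r) 0 := by
  obtain ⟨c, hc⟩ :=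
    eq_polynomial_of_dbar₀_eq_zero' (1 : ℂ) one_ne_zero 0 (fun w => by simp) k p h₀
  rw [hc z, hc 0]
  simp

/-- **`∂̄` is injective on functions vanishing at `z = 0`** (`τ = 1`): two members of
`𝓗^{k+1,r}_1(F)` with the same `∂̄` in the `z`-chart and the same value at `z = 0` coincide
(their difference has constant, hence vanishing, `z`-representative, so both pieces vanish).
[folklore] -/
theorem eq_of_dbar_sec₀_eq (k : ℕ) {p q : holderSections F (fun _ : ℂ => (1 : ℂ)) (k + 1) r}
    (h : ∀ z : ℂ, dbarAlong 1 (sec₀ (fun _ : ℂ => (1 : ℂ))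
        (p : ContDiffHolderFunction ℂ F (k + 1) r × ContDiffHolderFunction ℂ F (k + 1) r)) z =
      dbarAlong 1 (sec₀ (fun _ : ℂ => (1 : ℂ))
        (q : ContDiffHolderFunction ℂ F (k + 1) r × ContDiffHolderFunction ℂ F (k + 1) r)) z)
    (h0 : sec₀ (fun _ : ℂ => (1 : ℂ))
        (p : ContDiffHolderFunction ℂ F (k + 1) r × ContDiffHolderFunction ℂ F (k + 1) r) 0 =
      sec₀ (fun _ : ℂ => (1 : ℂ))
        (q : ContDiffHolderFunction ℂ F (k + 1) r × ContDiffHolderFunction ℂ F (k + 1) r) 0) :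
    p = q := by
  have hτ : ∀ w : ℂ, w ≠ 0 → (fun _ : ℂ => (1 : ℂ)) w ≠ 0 := fun _ _ => one_ne_zero
  have hτs : ContDiffOn ℝ ∞ (fun _ : ℂ => (1 : ℂ)) {w | w ≠ 0} := contDiffOn_const
  have hcoe : ((p - q : holderSections F (fun _ : ℂ => (1 : ℂ)) (k + 1) r) :
      ContDiffHolderFunction ℂ F (k + 1) r × ContDiffHolderFunction ℂ F (k + 1) r) =
      (p : ContDiffHolderFunction ℂ F (k + 1) r × ContDiffHolderFunction ℂ F (k + 1) r) -
        (q : ContDiffHolderFunction ℂ F (k + 1) r × ContDiffHolderFunction ℂ F (k + 1) r) :=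
    Submodule.coe_sub _ _ _
  -- the difference is `∂̄`-closed, hence constant, hence zero in the `z`-chart
  have hdiff : ∀ u : holderSections F (fun _ : ℂ => (1 : ℂ)) (k + 1) r,
      Differentiable ℝ (sec₀ (fun _ : ℂ => (1 : ℂ))
        (u : ContDiffHolderFunction ℂ F (k + 1) r × ContDiffHolderFunction ℂ F (k + 1) r)) :=
    fun u => (contDiff_sec₀ u.2 hτ hτs).differentiable (by exact_mod_cast Nat.succ_ne_zero k)
  have hsec : ∀ z, sec₀ (fun _ : ℂ => (1 : ℂ)) ((p - q : holderSections F (fun _ : ℂ => (1 : ℂ))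
      (k + 1) r) : ContDiffHolderFunction ℂ F (k + 1) r × ContDiffHolderFunction ℂ F (k + 1) r) z =
      sec₀ (fun _ : ℂ => (1 : ℂ)) (p : ContDiffHolderFunction ℂ F (k + 1) r ×
        ContDiffHolderFunction ℂ F (k + 1) r) z - sec₀ (fun _ : ℂ => (1 : ℂ))
          (q : ContDiffHolderFunction ℂ F (k + 1) r × ContDiffHolderFunction ℂ F (k + 1) r) z :=
    fun z => by rw [hcoe, sec₀_sub]
  have hd0 : ∀ z, dbarAlong 1 (sec₀ (fun _ : ℂ => (1 : ℂ)) ((p - q : holderSections F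
      (fun _ : ℂ => (1 : ℂ)) (k + 1) r) : ContDiffHolderFunction ℂ F (k + 1) r ×
        ContDiffHolderFunction ℂ F (k + 1) r)) z = 0 := fun z => by
    rw [show sec₀ (fun _ : ℂ => (1 : ℂ)) ((p - q : holderSections F (fun _ : ℂ => (1 : ℂ))
        (k + 1) r) : ContDiffHolderFunction ℂ F (k + 1) r × ContDiffHolderFunction ℂ F (k + 1) r) =
        fun y => sec₀ (fun _ : ℂ => (1 : ℂ)) (p : ContDiffHolderFunction ℂ F (k + 1) r ×
          ContDiffHolderFunction ℂ F (k + 1) r) y - sec₀ (fun _ : ℂ => (1 : ℂ))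
            (q : ContDiffHolderFunction ℂ F (k + 1) r × ContDiffHolderFunction ℂ F (k + 1) r) y
        from funext hsec,
      dbarAlong_sub (hdiff p z) (hdiff q z), h z, sub_self]
  have hzero : ∀ z, sec₀ (fun _ : ℂ => (1 : ℂ)) ((p - q : holderSections F (fun _ : ℂ => (1 : ℂ))
      (k + 1) r) : ContDiffHolderFunction ℂ F (k + 1) r × ContDiffHolderFunction ℂ F (k + 1) r) z =
      0 := fun z => by
    rw [sec₀_eq_sec₀_zero_of_dbar_eq_zero k (p - q) hd0 z, hsec 0, h0, sub_self]
  -- hence both pieces of the difference vanish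
  have h1 : ((p - q : holderSections F (fun _ : ℂ => (1 : ℂ)) (k + 1) r) :
      ContDiffHolderFunction ℂ F (k + 1) r × ContDiffHolderFunction ℂ F (k + 1) r).1 = 0 :=
    ContDiffHolderFunction.ext fun z => by
      rw [fst_eq_rhoCut_smul_sec₀ (p - q).2 z, hzero z, smul_zero,
        ContDiffHolderFunction.coe_zero, Pi.zero_apply]
  have h2 : ((p - q : holderSections F (fun _ : ℂ => (1 : ℂ)) (k + 1) r) :
      ContDiffHolderFunction ℂ F (k + 1) r × ContDiffHolderFunction ℂ F (k + 1) r).2 = 0 := by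
    refine ContDiffHolderFunction.ext fun w => ?_
    have hfun : (((p - q : holderSections F (fun _ : ℂ => (1 : ℂ)) (k + 1) r) :
        ContDiffHolderFunction ℂ F (k + 1) r × ContDiffHolderFunction ℂ F (k + 1) r).2 : ℂ → F) =
        fun _ => 0 := by
      refine Continuous.ext_on (dense_compl_singleton (0 : ℂ)) (ContDiffHolderFunction.continuous _)
        continuous_const fun w hw => ?_
      have hw : w ≠ 0 := hw
      rw [snd_eq_rhoCut_smul_sec₁ (p - q).2 w, sec₁_eq_smul_sec₀ (p - q).2 hτ hw, hzero, smul_zero,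
        smul_zero]
    rw [hfun, ContDiffHolderFunction.coe_zero, Pi.zero_apply]
  have hd' : p - q = 0 := Subtype.ext (Prod.ext h1 h2)
  exact sub_eq_zero.1 hd'

end Functions

/-! ### The two clutchings used downstream: `τ = 1` (functions) and `τ w = -w²` (vector fields)

The tree writes the functions on `S²` as `holderSections F (1 : ℂ → ℂ) k r` and the vector fields
as `holderSections F (fun w : ℂ => -w ^ 2) k r`
(`Literature/Analysis/Complex/RiemannSphereDbar.lean`); the following corollaries are the cases
`ε = 1, n = 0` and `ε = -1, n = 2` of the general statements, in exactly these syntactic forms. -/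

section Specialisations

variable {k : ℕ} {r : ℝ≥0}

/-- **Polynomials of degree `≤ n` are `∂̄`-closed members**, for any clutching function `τ` with
`τ w = ε wⁿ` pointwise (transport of `polynomial_mem`). [cite: Wendl2018, Prop. 2.53] -/
theorem polynomial_mem' {τ : ℂ → ℂ} (ε : ℂ) (hε : ε ≠ 0) (n : ℕ) (hτ : ∀ w, τ w = ε * w ^ n)
    (k : ℕ) (hr : r ≤ 1) (c : Fin (n + 1) → F) :
    ∃ p : holderSections F τ k r,
      (∀ z : ℂ, sec₀ τ (p : ContDiffHolderFunction ℂ F k r × ContDiffHolderFunction ℂ F k r) z =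
          ∑ i : Fin (n + 1), z ^ (i : ℕ) • c i) ∧
      (∀ w : ℂ, sec₁ τ (p : ContDiffHolderFunction ℂ F k r × ContDiffHolderFunction ℂ F k r) w =
          ε • ∑ i : Fin (n + 1), w ^ (n - (i : ℕ)) • c i) ∧
      (∀ z : ℂ, dbarAlong 1 (sec₀ τ
        (p : ContDiffHolderFunction ℂ F k r × ContDiffHolderFunction ℂ F k r)) z = 0) ∧
      (∀ w : ℂ, dbarAlong 1 (sec₁ τ
        (p : ContDiffHolderFunction ℂ F k r × ContDiffHolderFunction ℂ F k r)) w = 0) := by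
  obtain rfl : τ = fun w => ε * w ^ n := funext hτ
  exact polynomial_mem ε hε n k hr c

/-- **Functions: the kernel of `∂̄` consists of the constants** (`τ = 1`, i.e. `ε = 1`, `n = 0`;
both chart hypotheses stated, the second unused). [cite: Wendl2018, Prop. 2.53] -/
theorem eq_const_of_dbar_eq_zero_one [CompleteSpace F] (k : ℕ)
    (p : holderSections F (1 : ℂ → ℂ) (k + 1) r)
    (h₀ : ∀ z : ℂ, dbarAlong 1 (sec₀ (1 : ℂ → ℂ)
      (p : ContDiffHolderFunction ℂ F (k + 1) r × ContDiffHolderFunction ℂ F (k + 1) r)) z = 0)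
    (_h₁ : ∀ w : ℂ, dbarAlong 1 (sec₁ (1 : ℂ → ℂ)
      (p : ContDiffHolderFunction ℂ F (k + 1) r × ContDiffHolderFunction ℂ F (k + 1) r)) w = 0) :
    ∃ c : F, ∀ z : ℂ, sec₀ (1 : ℂ → ℂ)
      (p : ContDiffHolderFunction ℂ F (k + 1) r × ContDiffHolderFunction ℂ F (k + 1) r) z = c := by
  obtain ⟨c, hc⟩ :=
    eq_polynomial_of_dbar₀_eq_zero' (1 : ℂ) one_ne_zero 0 (fun w => by simp) k p h₀
  exact ⟨c 0, fun z => by rw [hc z]; simp⟩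

/-- **Functions: constants are `∂̄`-closed members** (`τ = 1`): for `c ∈ F` there is a member of
`𝓗^{k,r}_1(F)` (`r ≤ 1`) with both representatives `≡ c` and both `∂̄`'s zero.
[cite: Wendl2018, Prop. 2.53] -/
theorem const_mem_one (k : ℕ) (hr : r ≤ 1) (c : F) :
    ∃ p : holderSections F (1 : ℂ → ℂ) k r,
      (∀ z : ℂ, sec₀ (1 : ℂ → ℂ)
        (p : ContDiffHolderFunction ℂ F k r × ContDiffHolderFunction ℂ F k r) z = c) ∧
      (∀ w : ℂ, sec₁ (1 : ℂ → ℂ)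
        (p : ContDiffHolderFunction ℂ F k r × ContDiffHolderFunction ℂ F k r) w = c) ∧
      (∀ z : ℂ, dbarAlong 1 (sec₀ (1 : ℂ → ℂ)
        (p : ContDiffHolderFunction ℂ F k r × ContDiffHolderFunction ℂ F k r)) z = 0) ∧
      (∀ w : ℂ, dbarAlong 1 (sec₁ (1 : ℂ → ℂ)
        (p : ContDiffHolderFunction ℂ F k r × ContDiffHolderFunction ℂ F k r)) w = 0) := by
  obtain ⟨p, h0, h1, hd0, hd1⟩ :=
    polynomial_mem' (τ := (1 : ℂ → ℂ)) (1 : ℂ) one_ne_zero 0 (fun w => by simp) k hr fun _ => c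
  refine ⟨p, fun z => ?_, fun w => ?_, hd0, hd1⟩
  · rw [h0 z]
    simp
  · rw [h1 w]
    simp

/-- **Vector fields: the kernel of `∂̄` consists of the quadratic polynomials** (`τ w = -w²`,
i.e. `ε = -1`, `n = 2`: the Möbius Lie algebra `{(a + b z + c z²) ∂_z}`; both chart hypotheses
stated, the second unused). [cite: Wendl2018, Prop. 2.53] -/
theorem eq_quadratic_of_dbar_eq_zero_neg_sq [CompleteSpace F] (k : ℕ)
    (p : holderSections F (fun w : ℂ => -w ^ 2) (k + 1) r)
    (h₀ : ∀ z : ℂ, dbarAlong 1 (sec₀ (fun w : ℂ => -w ^ 2)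
      (p : ContDiffHolderFunction ℂ F (k + 1) r × ContDiffHolderFunction ℂ F (k + 1) r)) z = 0)
    (_h₁ : ∀ w : ℂ, dbarAlong 1 (sec₁ (fun w : ℂ => -w ^ 2)
      (p : ContDiffHolderFunction ℂ F (k + 1) r × ContDiffHolderFunction ℂ F (k + 1) r)) w = 0) :
    ∃ a b c : F, ∀ z : ℂ, sec₀ (fun w : ℂ => -w ^ 2)
      (p : ContDiffHolderFunction ℂ F (k + 1) r × ContDiffHolderFunction ℂ F (k + 1) r) z =
        a + z • b + z ^ 2 • c := by
  obtain ⟨c, hc⟩ :=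
    eq_polynomial_of_dbar₀_eq_zero' (-1 : ℂ) (neg_ne_zero.2 one_ne_zero) 2
      (fun w => by ring) k p h₀
  refine ⟨c 0, c 1, c 2, fun z => ?_⟩
  rw [hc z, Fin.sum_univ_three]
  simp

/-- **Vector fields: quadratic polynomials are `∂̄`-closed members** (`τ w = -w²`): for
`a b c ∈ F` there is a member of `𝓗^{k,r}_{-w²}(F)` (`r ≤ 1`) with `z`-representative
`a + z • b + z² • c`, `w`-representative `-(w² • a + w • b + c)`, and both `∂̄`'s zero.
[cite: Wendl2018, Prop. 2.53] -/
theorem quadratic_mem_neg_sq (k : ℕ) (hr : r ≤ 1) (a b c : F) :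
    ∃ p : holderSections F (fun w : ℂ => -w ^ 2) k r,
      (∀ z : ℂ, sec₀ (fun w : ℂ => -w ^ 2)
        (p : ContDiffHolderFunction ℂ F k r × ContDiffHolderFunction ℂ F k r) z =
          a + z • b + z ^ 2 • c) ∧
      (∀ w : ℂ, sec₁ (fun w : ℂ => -w ^ 2)
        (p : ContDiffHolderFunction ℂ F k r × ContDiffHolderFunction ℂ F k r) w =
          -(w ^ 2 • a + w • b + c)) ∧
      (∀ z : ℂ, dbarAlong 1 (sec₀ (fun w : ℂ => -w ^ 2)
        (p : ContDiffHolderFunction ℂ F k r × ContDiffHolderFunction ℂ F k r)) z = 0) ∧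
      (∀ w : ℂ, dbarAlong 1 (sec₁ (fun w : ℂ => -w ^ 2)
        (p : ContDiffHolderFunction ℂ F k r × ContDiffHolderFunction ℂ F k r)) w = 0) := by
  obtain ⟨p, h0, h1, hd0, hd1⟩ :=
    polynomial_mem' (τ := fun w : ℂ => -w ^ 2) (-1 : ℂ) (neg_ne_zero.2 one_ne_zero) 2
      (fun w => by ring) k hr ![a, b, c]
  refine ⟨p, fun z => ?_, fun w => ?_, hd0, hd1⟩
  · rw [h0 z, Fin.sum_univ_three]
    simp
  · rw [h1 w, Fin.sum_univ_three]
    simp only [Fin.isValue, Fin.val_zero, Nat.sub_zero, Matrix.cons_val_zero, Fin.val_one,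
      Matrix.cons_val_one, Fin.val_two, Nat.sub_self, pow_zero, one_smul, neg_smul, smul_add,
      neg_add, Nat.add_one_sub_one, pow_one, Matrix.cons_val]

end Specialisations

end RiemannSphere

end Literature.Analysis.Complex

end
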